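import Mathlib
import Summits.KontsevichZagierPeriods.KontsevichZagierPeriods.Theorems.SoloInformedDivisionTorsion
import Summits.KontsevichZagierPeriods.KontsevichZagierPeriods.Theorems.SoloInformedKummerHeuman
import HarnessLib
import HarnessLib.Audit

/-!
# Division by translation IX: THEOREM XXIX(ii) KERNEL — circular torsion at every order (solo-informed, s43)

The circular half of the torsion dichotomy.  Let `0 < m' < 1` be algebraic, `m = 1 − m'`, and let
`(s_j)` be a division chain of order `q` for the COMPLEMENTARY modulus `m'` (`SoloInformedDivChain m' q`;
model `s_j = sn(jK'/q | m')`).  For `0 < p < q`, `s = s_p`, the pole parameter `n = 1 − m' s²` lies in the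
circular band `(m, 1)`, and THEOREM XXVIII(b) KERNEL (`soloInformed_kummer_heuman`, Heuman's formula as
moves) reads `2⟦[pt,c]⟧(⟦Π_n⟧ − ⟦K⟧) + 2(⟦E⟧⟦F♭⟧ + ⟦K⟧⟦E♭⟧ − ⟦K⟧⟦F♭⟧) = ⟦π⟧` with the incomplete
complementary integrals `F♭ = [(0,s),κ']`, `E♭ = [(0,s),e']` and `c = m' s √(1−s²)/√(1−m' s²)`.  The
division chain converts them (parts III, VI): `q⟦F♭⟧ = p⟦K'⟧`, `q(⟦E♭⟧ + ⟦ζ_p⟧) = p(⟦E'⟧ + ⟦ζ_q⟧)`, and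
LEGENDRE'S RELATION KERNEL (`soloInformed_legendre_relation`, THEOREM XVII) absorbs the complete products:

  **`2q·⟦[pt,c]⟧·(⟦Π_n⟧ − ⟦K⟧) + 2(p⟦ζ_q⟧ − q⟦ζ_p⟧)·⟦K⟧ + p·⟦π⟧ = q·⟦π⟧`**   (`soloInformed_divChain_circular`),

for ALL representations; inverting the algebraic point class `2qc`:

  **`⟦Π(1 − m' s_p² | 1 − m')⟧ = ⟦[pt, A]⟧·⟦K⟧ + ⟦[pt, B]⟧·⟦π⟧`,
   `A = 1 − (pζ_q − qζ_p)/(qc)`,  `B = (q − p)/(2qc)`**              (`soloInformed_divChain_circular_pointClass`)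

— THEOREM XXIX(ii) (`A_r = 1 − δ₂ Z(rK'|k')`, `B_r = δ₂(1−r)/2`) at EVERY torsion order `q`, by
one-dimensional moves, given the chain; in values `Π = A·K + B·π` (`…_value`).  With the trisection chain of
part VIII (`m' = (2s−1)/(s³(2−s))`), e.g. `s = ⅔`: `9·Π(⅝ | 5/32) = 4K + 4√2·π`, `9·Π(¼ | 5/32) = 5K + 2√2·π`.

References: A. M. Legendre, *Traité* I (1825), ch. 23; C. Heuman, J. Math. Phys. 20 (1941) 127–206;
Abramowitz–Stegun 17.7.14; M. Kontsevich, D. Zagier, *Periods* (2001), §1.2; this work.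
-/

noncomputable section

open MeasureTheory Set Filter
open scoped Classical

open Literature.NumberTheory.Transcendental Literature.NumberTheory.Transcendental.KZ
open Literature.ModelTheory.ExponentialFields

namespace Summit.KontsevichZagierPeriods.KontsevichZagierPeriods.Theorems

/-- The circular Kummer scalar `c = m' s √(1−s²)/√(1−m' s²)` is algebraic. [folklore] -/
theorem soloInformed_circScalar_isAlgebraic {m' s : ℝ} (hm' : m' ∈ Ioo (0:ℝ) 1)
    (hm'a : IsAlgebraic ℚ m') (hs : s ∈ Ioo (0:ℝ) 1) (hsa : IsAlgebraic ℚ s) :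
    IsAlgebraic ℚ (m' * s * √(1 - s ^ 2) / √(1 - m' * s ^ 2)) := by
  have h := soloInformed_kummerHeuman_scalar_isAlgebraic (soloInformed_kummerHeuman_compl hm')
    (isAlgebraic_one.sub hm'a) hs hsa
  simpa only [sub_sub_cancel] using h

/-- … and positive. [folklore] -/
theorem soloInformed_circScalar_pos {m' s : ℝ} (hm' : m' ∈ Ioo (0:ℝ) 1) (hs : s ∈ Ioo (0:ℝ) 1) :
    0 < m' * s * √(1 - s ^ 2) / √(1 - m' * s ^ 2) := by
  have h1 : 0 < 1 - s ^ 2 := by nlinarith [hs.1, hs.2]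
  have h2 : 0 < 1 - m' * s ^ 2 := by nlinarith [hm'.1, hm'.2, hs.1, hs.2, mul_pos hm'.1 hs.1]
  exact div_pos (mul_pos (mul_pos hm'.1 hs.1) (Real.sqrt_pos.2 h1)) (Real.sqrt_pos.2 h2)

/-- **THEOREM XXIX(ii) KERNEL (circular torsion, every order), multiplicative form.**  For a division
chain of order `q` for the complementary modulus `m'`, `0 < p < q`, `s = s_p`, `n = 1 − m' s²`, and ALL
representations `Π_n = [(0,1), κ/(1−nx²)]`, `K = [(0,1), κ]` of modulus `1 − m'`:
`2q⟦[pt,c]⟧(⟦Π_n⟧ − ⟦K⟧) + 2(p⟦[pt,ζ_q]⟧ − q⟦[pt,ζ_p]⟧)⟦K⟧ + p⟦π⟧ = q⟦π⟧` in `P`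
(`c = m' s√(1−s²)/√(1−m' s²)`): Heuman KERNEL + division chain (III, VI) + Legendre KERNEL. [this work] -/
theorem soloInformed_divChain_circular {m' : ℝ} {q : ℕ} (c : SoloInformedDivChain m' q)
    (hm' : m' ∈ Ioo (0:ℝ) 1) (hm'a : IsAlgebraic ℚ m') {p : ℕ} (hp0 : 0 < p) (hpq : p < q)
    (PN K : IntegralRep 1) (hPNd : PN.domain = {x | x 0 ∈ Ioo (0:ℝ) 1})
    (hPNi : EqOn PN.integrand (fun x => (1 - (1 - m' * c.s p ^ 2) * x 0 ^ 2)⁻¹ *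
      ((√(1 - x 0 ^ 2))⁻¹ * (√(1 - (1 - m') * x 0 ^ 2))⁻¹)) PN.domain)
    (hKd : K.domain = {x | x 0 ∈ Ioo (0:ℝ) 1})
    (hKi : EqOn K.integrand (fun x => (√(1 - x 0 ^ 2))⁻¹ * (√(1 - (1 - m') * x 0 ^ 2))⁻¹)
      K.domain)
    (hzq : IsAlgebraic ℚ (c.zeta q)) (hzp : IsAlgebraic ℚ (c.zeta p)) :
    2 * (q : FormalPeriodRing) * toFormalPeriod (of (IntegralRep.unit.constMul
        (m' * c.s p * √(1 - c.s p ^ 2) / √(1 - m' * c.s p ^ 2))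
        (soloInformed_circScalar_isAlgebraic hm' hm'a
          (soloInformed_divChain_mem_Ioo c hm' hm'a hp0 hpq)
          (soloInformed_divChain_mem c hm' hm'a p hpq.le).2))) *
        (toFormalPeriod (of PN) - toFormalPeriod (of K)) +
      2 * ((p : FormalPeriodRing) * toFormalPeriod (of (IntegralRep.unit.constMul (c.zeta q) hzq)) -
        (q : FormalPeriodRing) * toFormalPeriod (of (IntegralRep.unit.constMul (c.zeta p) hzp))) *
        toFormalPeriod (of K) +
      (p : FormalPeriodRing) * toFormalPeriod (of KZ.piRep) =
      (q : FormalPeriodRing) * toFormalPeriod (of KZ.piRep) := by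
  have hσ := soloInformed_divChain_mem_Ioo c hm' hm'a hp0 hpq
  have hσa := (soloInformed_divChain_mem c hm' hm'a p hpq.le).2
  have hm := soloInformed_kummerHeuman_compl hm'
  have hma : IsAlgebraic ℚ (1 - m') := isAlgebraic_one.sub hm'a
  have hcs := soloInformed_circScalar_isAlgebraic hm' hm'a hσ hσa
  obtain ⟨E, hEd, hEi⟩ := soloInformed_exists_ellipticE_rep (1 - m') hm hma
  obtain ⟨K', hK'd, hK'i⟩ := soloInformed_exists_ellipticK_rep m' hm' hm'a
  obtain ⟨E', hE'd, hE'i⟩ := soloInformed_exists_ellipticE_rep m' hm' hm'a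
  obtain ⟨Fc, hFcd, hFci⟩ := soloInformed_exists_divChain_rep c hm' hm'a hpq.le
  obtain ⟨Ec, hEcd, hEci⟩ := soloInformed_exists_divChain_repE c hm' hm'a hpq.le
  have H := soloInformed_kummer_heuman (1 - m') (c.s p) hm hma hσ hσa PN K E Fc Ec hPNd
    (fun x hx => by simp only [sub_sub_cancel]; exact hPNi hx) hKd hKi hEd (fun x _ => hEi x)
    hFcd (fun x _ => by simp only [sub_sub_cancel]; exact hFci x)
    hEcd (fun x _ => by simp only [sub_sub_cancel]; exact hEci x)
  have L := soloInformed_legendre_relation m' hm' hm'a K' K E' E hK'd (fun x _ => hK'i x) hKd hKi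
    hE'd (fun x _ => hE'i x) hEd (fun x _ => hEi x)
  have T1 := soloInformed_divChain_torsion c hm' hm'a K' Fc hpq.le hK'd (fun x _ => hK'i x) hFcd
    (fun x _ => hFci x)
  have T2 := soloInformed_divChain_torsionE c hm' hm'a E' Ec hpq.le hE'd (fun x _ => hE'i x) hEcd
    (fun x _ => hEci x) hzq hzp
  have P0 : toFormalPeriod (of (IntegralRep.unit.constMul _
      (soloInformed_kummerHeuman_scalar_isAlgebraic hm hma hσ hσa))) =
      toFormalPeriod (of (IntegralRep.unit.constMul _ hcs)) :=
    soloInformed_pointRep_congr _ _ (by rw [sub_sub_cancel])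
  rw [P0] at H
  linear_combination (q : FormalPeriodRing) * H - (p : FormalPeriodRing) * L +
    (2 * toFormalPeriod (of K) - 2 * toFormalPeriod (of E)) * T1 - 2 * toFormalPeriod (of K) * T2

/-- **THEOREM XXIX(ii) KERNEL: the point-class form.**  With `c, ζ_p, ζ_q` as above,
`⟦Π(1 − m' s_p² | 1 − m')⟧ = ⟦[pt, A]⟧⟦K⟧ + ⟦[pt, B]⟧⟦π⟧`, `A = 1 − (pζ_q − qζ_p)/(qc)`,
`B = ((q−p)/2)/(qc)` — an algebraic combination of `K` and `π` at every circular torsion parameter.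
[this work] -/
theorem soloInformed_divChain_circular_pointClass {m' : ℝ} {q : ℕ} (c : SoloInformedDivChain m' q)
    (hm' : m' ∈ Ioo (0:ℝ) 1) (hm'a : IsAlgebraic ℚ m') {p : ℕ} (hp0 : 0 < p) (hpq : p < q)
    (PN K : IntegralRep 1) (hPNd : PN.domain = {x | x 0 ∈ Ioo (0:ℝ) 1})
    (hPNi : EqOn PN.integrand (fun x => (1 - (1 - m' * c.s p ^ 2) * x 0 ^ 2)⁻¹ *
      ((√(1 - x 0 ^ 2))⁻¹ * (√(1 - (1 - m') * x 0 ^ 2))⁻¹)) PN.domain)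
    (hKd : K.domain = {x | x 0 ∈ Ioo (0:ℝ) 1})
    (hKi : EqOn K.integrand (fun x => (√(1 - x 0 ^ 2))⁻¹ * (√(1 - (1 - m') * x 0 ^ 2))⁻¹)
      K.domain) :
    IsAlgebraic ℚ (1 - ((q : ℝ) * (m' * c.s p * √(1 - c.s p ^ 2) / √(1 - m' * c.s p ^ 2)))⁻¹ *
        ((p : ℝ) * c.zeta q - (q : ℝ) * c.zeta p)) ∧
    IsAlgebraic ℚ (((q : ℝ) * (m' * c.s p * √(1 - c.s p ^ 2) / √(1 - m' * c.s p ^ 2)))⁻¹ *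
        (((q : ℝ) - (p : ℝ)) / 2)) ∧
      ∀ hA : IsAlgebraic ℚ (1 - ((q : ℝ) * (m' * c.s p * √(1 - c.s p ^ 2) /
          √(1 - m' * c.s p ^ 2)))⁻¹ * ((p : ℝ) * c.zeta q - (q : ℝ) * c.zeta p)),
      ∀ hB : IsAlgebraic ℚ (((q : ℝ) * (m' * c.s p * √(1 - c.s p ^ 2) /
          √(1 - m' * c.s p ^ 2)))⁻¹ * (((q : ℝ) - (p : ℝ)) / 2)),
        toFormalPeriod (of PN) =
          toFormalPeriod (of (IntegralRep.unit.constMul _ hA)) * toFormalPeriod (of K) +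
          toFormalPeriod (of (IntegralRep.unit.constMul _ hB)) * toFormalPeriod (of KZ.piRep) := by
  have hσ := soloInformed_divChain_mem_Ioo c hm' hm'a hp0 hpq
  have hσa := (soloInformed_divChain_mem c hm' hm'a p hpq.le).2
  have hcs := soloInformed_circScalar_isAlgebraic hm' hm'a hσ hσa
  have hzq := soloInformed_divChain_zeta_isAlgebraic c hm' hm'a q le_rfl
  have hzp := soloInformed_divChain_zeta_isAlgebraic c hm' hm'a p hpq.le
  set cs := m' * c.s p * √(1 - c.s p ^ 2) / √(1 - m' * c.s p ^ 2)
  have hq0 : 0 < q := lt_of_le_of_lt (Nat.zero_le p) hpq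
  have hqa : IsAlgebraic ℚ (q : ℝ) := isAlgebraic_nat q
  have hpa : IsAlgebraic ℚ (p : ℝ) := isAlgebraic_nat p
  have h2a : IsAlgebraic ℚ (2 : ℝ) := by simpa using isAlgebraic_nat (R := ℚ) (A := ℝ) 2
  have h2i : IsAlgebraic ℚ (2 : ℝ)⁻¹ := h2a.inv
  have hu : IsAlgebraic ℚ ((q : ℝ) * cs) := hqa.mul hcs
  have hu0 : (q : ℝ) * cs ≠ 0 :=
    (mul_pos (Nat.cast_pos.2 hq0) (soloInformed_circScalar_pos hm' hσ)).ne'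
  have hui : IsAlgebraic ℚ ((q : ℝ) * cs)⁻¹ := hu.inv
  have hz : IsAlgebraic ℚ ((p : ℝ) * c.zeta q - (q : ℝ) * c.zeta p) :=
    (hpa.mul hzq).sub (hqa.mul hzp)
  have hw : IsAlgebraic ℚ (((q : ℝ) * cs)⁻¹ * ((p : ℝ) * c.zeta q - (q : ℝ) * c.zeta p)) :=
    hui.mul hz
  have hA : IsAlgebraic ℚ (1 - ((q : ℝ) * cs)⁻¹ * ((p : ℝ) * c.zeta q - (q : ℝ) * c.zeta p)) :=
    isAlgebraic_one.sub hw
  have hd : IsAlgebraic ℚ ((q : ℝ) - (p : ℝ)) := hqa.sub hpa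
  have hh : IsAlgebraic ℚ (((q : ℝ) - (p : ℝ)) / 2) := by
    rw [div_eq_mul_inv]; exact hd.mul h2i
  have hB : IsAlgebraic ℚ (((q : ℝ) * cs)⁻¹ * (((q : ℝ) - (p : ℝ)) / 2)) := hui.mul hh
  refine ⟨hA, hB, fun hA' hB' => ?_⟩
  have A := soloInformed_divChain_circular c hm' hm'a hp0 hpq PN K hPNd hPNi hKd hKi hzq hzp
  -- point-class arithmetic
  have P1 : 2 * (q : FormalPeriodRing) * toFormalPeriod (of (IntegralRep.unit.constMul cs hcs)) =
      2 * toFormalPeriod (of (IntegralRep.unit.constMul ((q : ℝ) * cs) hu)) := by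
    rw [mul_assoc, ← toFormalPeriod_of_unit_constMul_natCast q hqa, soloInformed_pointRep_mul]
  have hpz : IsAlgebraic ℚ ((p : ℝ) * c.zeta q) := hpa.mul hzq
  have hqz : IsAlgebraic ℚ ((q : ℝ) * c.zeta p) := hqa.mul hzp
  have hsum : IsAlgebraic ℚ ((p : ℝ) * c.zeta q - (q : ℝ) * c.zeta p + (q : ℝ) * c.zeta p) :=
    hz.add hqz
  have P2 : (p : FormalPeriodRing) * toFormalPeriod (of (IntegralRep.unit.constMul (c.zeta q) hzq)) -
      (q : FormalPeriodRing) * toFormalPeriod (of (IntegralRep.unit.constMul (c.zeta p) hzp)) =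
      toFormalPeriod (of (IntegralRep.unit.constMul _ hz)) := by
    rw [← toFormalPeriod_of_unit_constMul_natCast p hpa, ← toFormalPeriod_of_unit_constMul_natCast
      q hqa, soloInformed_pointRep_mul _ _ hpa hzq hpz, soloInformed_pointRep_mul _ _ hqa hzp hqz]
    have h := soloInformed_pointRep_add _ _ hz hqz hsum
    rw [soloInformed_pointRep_congr hsum hpz (by ring)] at h
    linear_combination -h
  have P3 := soloInformed_pointRep_inv_mul ((q : ℝ) * cs) hu hu0 hui
  have P4 := soloInformed_pointRep_mul _ _ hui hz hw
  -- `⟦A⟧ + ⟦w⟧ = 1`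
  have hAw : IsAlgebraic ℚ (1 - ((q : ℝ) * cs)⁻¹ * ((p : ℝ) * c.zeta q - (q : ℝ) * c.zeta p) +
      ((q : ℝ) * cs)⁻¹ * ((p : ℝ) * c.zeta q - (q : ℝ) * c.zeta p)) := hA.add hw
  have P5 := soloInformed_pointRep_add _ _ hA' hw hAw
  rw [soloInformed_pointRep_congr hAw isAlgebraic_one (by ring),
    soloInformed_pointRep_one (isAlgebraic_one (R := ℚ) (A := ℝ))] at P5
  -- `⟦½⟧ · 2 = 1`
  have P6 : toFormalPeriod (of (IntegralRep.unit.constMul (2 : ℝ)⁻¹ h2i)) * 2 = 1 := by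
    have h := soloInformed_pointRep_inv_mul (2 : ℝ) h2a two_ne_zero h2i
    have h2 : toFormalPeriod (of (IntegralRep.unit.constMul (2 : ℝ) h2a)) = 2 := by
      have h' := toFormalPeriod_of_unit_constMul_natCast 2 (isAlgebraic_nat 2)
      rw [soloInformed_pointRep_congr (isAlgebraic_nat 2) h2a (by norm_num)] at h'
      simpa using h'
    rwa [h2] at h
  -- `⟦(q-p)/2⟧ = ⟦½⟧ (q - p)` and `⟦B⟧ = ⟦u⁻¹⟧ ⟦(q-p)/2⟧`
  have hdp : IsAlgebraic ℚ ((q : ℝ) - (p : ℝ) + (p : ℝ)) := hd.add hpa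
  have P7 : toFormalPeriod (of (IntegralRep.unit.constMul _ hd)) =
      (q : FormalPeriodRing) - (p : FormalPeriodRing) := by
    have h := soloInformed_pointRep_add _ _ hd hpa hdp
    rw [soloInformed_pointRep_congr hdp hqa (by ring), toFormalPeriod_of_unit_constMul_natCast p hpa,
      toFormalPeriod_of_unit_constMul_natCast q hqa] at h
    linear_combination h
  have h2d : IsAlgebraic ℚ ((2 : ℝ)⁻¹ * ((q : ℝ) - (p : ℝ))) := h2i.mul hd
  have P8 : toFormalPeriod (of (IntegralRep.unit.constMul _ hh)) =
      toFormalPeriod (of (IntegralRep.unit.constMul (2 : ℝ)⁻¹ h2i)) *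
        ((q : FormalPeriodRing) - (p : FormalPeriodRing)) := by
    rw [← P7, soloInformed_pointRep_mul _ _ h2i hd h2d]
    exact soloInformed_pointRep_congr hh h2d (by ring)
  have P9 := soloInformed_pointRep_mul _ _ hui hh hB'
  rw [P1, P2] at A
  -- Step 1: `Π − K = ⟦u⁻¹⟧(⟦(q−p)/2⟧ π − ⟦z⟧ K)`
  have S1 : toFormalPeriod (of PN) - toFormalPeriod (of K) =
      toFormalPeriod (of (IntegralRep.unit.constMul _ hui)) *
        (toFormalPeriod (of (IntegralRep.unit.constMul _ hh)) * toFormalPeriod (of KZ.piRep) -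
          toFormalPeriod (of (IntegralRep.unit.constMul _ hz)) * toFormalPeriod (of K)) := by
    rw [P8]
    linear_combination
      toFormalPeriod (of (IntegralRep.unit.constMul _ hui)) *
          toFormalPeriod (of (IntegralRep.unit.constMul (2 : ℝ)⁻¹ h2i)) * A -
        (toFormalPeriod (of PN) - toFormalPeriod (of K)) *
          (toFormalPeriod (of (IntegralRep.unit.constMul (2 : ℝ)⁻¹ h2i)) * 2) * P3 -
        (toFormalPeriod (of PN) - toFormalPeriod (of K)) * P6 -
        toFormalPeriod (of (IntegralRep.unit.constMul _ hui)) *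
          toFormalPeriod (of (IntegralRep.unit.constMul _ hz)) * toFormalPeriod (of K) * P6
  rw [← P9]
  linear_combination S1 - toFormalPeriod (of K) * P5 - toFormalPeriod (of K) * P4

/-- **THEOREM XXIX(ii), numerically:** `Π(1 − m' s_p² | 1 − m') = A·K(1−m') + B·π` with the algebraic
`A = 1 − (pζ_q − qζ_p)/(qc)`, `B = ((q−p)/2)/(qc)`. [this work] -/
theorem soloInformed_divChain_circular_value {m' : ℝ} {q : ℕ} (c : SoloInformedDivChain m' q)
    (hm' : m' ∈ Ioo (0:ℝ) 1) (hm'a : IsAlgebraic ℚ m') {p : ℕ} (hp0 : 0 < p) (hpq : p < q)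
    (PN K : IntegralRep 1) (hPNd : PN.domain = {x | x 0 ∈ Ioo (0:ℝ) 1})
    (hPNi : EqOn PN.integrand (fun x => (1 - (1 - m' * c.s p ^ 2) * x 0 ^ 2)⁻¹ *
      ((√(1 - x 0 ^ 2))⁻¹ * (√(1 - (1 - m') * x 0 ^ 2))⁻¹)) PN.domain)
    (hKd : K.domain = {x | x 0 ∈ Ioo (0:ℝ) 1})
    (hKi : EqOn K.integrand (fun x => (√(1 - x 0 ^ 2))⁻¹ * (√(1 - (1 - m') * x 0 ^ 2))⁻¹)
      K.domain) :
    PN.value = (1 - ((q : ℝ) * (m' * c.s p * √(1 - c.s p ^ 2) / √(1 - m' * c.s p ^ 2)))⁻¹ *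
        ((p : ℝ) * c.zeta q - (q : ℝ) * c.zeta p)) * K.value +
      (((q : ℝ) * (m' * c.s p * √(1 - c.s p ^ 2) / √(1 - m' * c.s p ^ 2)))⁻¹ *
        (((q : ℝ) - (p : ℝ)) / 2)) * Real.pi := by
  obtain ⟨hA, hB, h⟩ := soloInformed_divChain_circular_pointClass c hm' hm'a hp0 hpq PN K hPNd
    hPNi hKd hKi
  have e := congrArg evalP (h hA hB)
  simpa only [map_mul, map_add, evalP_toFormalPeriod_of, IntegralRep.value_constMul,
    IntegralRep.value_unit, mul_one, KZ.piRep_value] using e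

end Summit.KontsevichZagierPeriods.KontsevichZagierPeriods.Theorems

end
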